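import Literature.NumberTheory.EllipticCurves.PNewBranchFrobeniusGaloisLattice
import Literature.NumberTheory.EllipticCurves.PadicCoeffIntegersFrobeniusData
import Literature.NumberTheory.EllipticCurves.OrdinaryNewformDatumSelfDualTwist
import Literature.NumberTheory.GaloisRepresentations.FramedRepBaseChange
import Literature.NumberTheory.GaloisRepresentations.CyclotomicCharacterFrobeniusProofs
import Literature.NumberTheory.GaloisRepresentations.FrobeniusDivisionDensityProofs
import Literature.NumberTheory.GaloisRepresentations.OddAbsolutelyIrreducibleProofs
import Literature.NumberTheory.GaloisRepresentations.HeckeCharacterProofs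
import Summits.BirchSwinnertonDyer.BirchSwinnertonDyer.Theorems.EisensteinPrimesBSDpOnCellCTelescopeBranchUntwistedOfFrobenius
import HarnessLib

/-!
# [telescope — width x2-p2 g25, 2026-08-30] Brick G2 (instantiation, members) of «(F) CONSTRUCTED IN TREE»: the members'
Deligne representations transported to `ℤ_p` along (F-rat) — unramified, Frobenius characteristic polynomial / trace /
determinant, ODD

Crux 4 `BSDpOnCellC` (stmt-BirchSwinnertonDyer-19034), line «telescope» v19; ʳ-chain (director (610); host map STATUS l.7169 /
l.7197 (b); LEAD g7 `RCHAIN-SPEC-g7.md` §2–§3). A member `g_t` of the chart carries `Δ = (D t).Δ : OrdinaryNewformDatum g p ι`, whose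
`Δ.ρ : Γ_ℚ →ₜ* GL₂(𝒪)`, `𝒪 = padicCoeffIntegers ι`, is unramified at `ℓ ∤ Mp` with arithmetic-Frobenius characteristic polynomial
`X² − ι(a_ℓ(g))X + ℓ^{k−1}` (`Δ.charpoly`). Under (F-rat) (`ℤ_p → 𝒪` onto, hence a homeomorphic ring isomorphism) this file
produces the `ℤ_p`-FRAMED representation the gluing (G1/B3) consumes:

* §1 `continuous_symm_of_surjective_algebraMap` — the inverse of `ℤ_p ≃ 𝒪` is continuous (compact ↠ Hausdorff);
  `toPadicAlgCl_algebraMap` — `𝒪 → ℚ̄_p` ∘ `ℤ_p → 𝒪` = `ℤ_p → ℚ_p → ℚ̄_p`;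
* §2 `exists_padicInt_frame` — `ρ : FramedGaloisRep ℚ ℤ_[p] 2` with `(ρ σ).map (ℤ_p → 𝒪) = Δ.ρ σ`, unramified at `ℓ ∤ Mp`, and at
  every arithmetic Frobenius there: `charpoly` maps to `X² − ι(a_ℓ)X + ℓ^{k−1}`, `trace ↦ ι(a_ℓ(g))`, `det = ℓ^{k−1}`;
* §3 `det_eq_neg_one_of_isComplexConjugation` — ODDNESS from the Frobenius determinants alone: a continuous
  `ρ : Γ_ℚ →ₜ* GL₂(ℤ_p)` with `det ρ(Frob_v) = ℓ_v^n` off a finite set, `n` odd, has `det ρ(c) = −1` at every complex conjugation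
  (`det ρ = ε^n` by the tree's Frobenius-division density `absoluteGaloisGroup.monoidHom_eq_of_frobenius'`, `ε(c) = −1`).

Helper toward crux 4 (`--supports`); closes NO registered stub, proves no cited fact and no summit statement; BSD is proved for no curve.
-/

noncomputable section

set_option autoImplicit false
set_option linter.dupNamespace false

open scoped MatrixGroups ModularForm NumberField
open NumberField IsDedekindDomain Field CongruenceSubgroup Matrix UpperHalfPlane
  Literature.NumberTheory.GaloisRepresentations
  Literature.NumberTheory.EllipticCurves.ModularForms
  Literature.NumberTheory.EllipticCurves.GreenbergSelmer

namespace Summit.BirchSwinnertonDyer.BirchSwinnertonDyer.Theorems.TelescopeBranchMemberFrames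

variable {p : ℕ} [Fact p.Prime]

/-! ### §1. The coefficient isomorphism `ℤ_p ≃ 𝒪` of a `ℚ_p`-rational member -/

section Coefficients

variable {M : ℕ} {k : ℤ} {g : CuspForm (Gamma0 M) k} (ι' : coeffField g →+* PadicAlgCl p)

/-- `𝒪 → ℚ̄_p` composed with the structure map `ℤ_p → 𝒪` is `ℤ_p → ℚ_p → ℚ̄_p`. [folklore] -/
theorem toPadicAlgCl_algebraMap (z : ℤ_[p]) :
    padicCoeffIntegers.toPadicAlgCl ι' (algebraMap ℤ_[p] (padicCoeffIntegers ι') z) =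
      algebraMap ℚ_[p] (PadicAlgCl p) (z : ℚ_[p]) := by
  rw [padicCoeffIntegers.toPadicAlgCl_apply, padicCoeffIntegers.algebraMap_padicInt_eq, padicCoeffIntegers.coe_ofPadicInt,
    IsScalarTower.algebraMap_apply ℚ_[p] (padicCoeffField ι') (PadicAlgCl p)]
  rfl

/-- As ring homomorphisms: `toPadicAlgCl ∘ algebraMap = (ℚ_p → ℚ̄_p) ∘ (ℤ_p → ℚ_p)`. [folklore] -/
theorem toPadicAlgCl_comp_algebraMap :
    (padicCoeffIntegers.toPadicAlgCl ι').comp (algebraMap ℤ_[p] (padicCoeffIntegers ι')) =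
      (algebraMap ℚ_[p] (PadicAlgCl p)).comp PadicInt.Coe.ringHom :=
  RingHom.ext fun z => toPadicAlgCl_algebraMap ι' z

/-- `toPadicAlgCl : 𝒪 → ℚ̄_p` is injective (it is a composite of subtype coercions). [folklore] -/
theorem toPadicAlgCl_injective : Function.Injective (padicCoeffIntegers.toPadicAlgCl ι') := by
  intro a b h
  rw [padicCoeffIntegers.toPadicAlgCl_apply, padicCoeffIntegers.toPadicAlgCl_apply] at h
  exact Subtype.ext (Subtype.ext h)

/-- Under (F-rat) the structure map `ℤ_p → 𝒪` is a ring ISOMORPHISM whose inverse is continuous (a continuous bijection from the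
compact `ℤ_p` onto the Hausdorff `𝒪`). [folklore] -/
theorem exists_ringEquiv_of_surjective_algebraMap (hrat : Function.Surjective (algebraMap ℤ_[p] (padicCoeffIntegers ι'))) :
    ∃ e : ℤ_[p] ≃+* padicCoeffIntegers ι', (∀ z, e z = algebraMap ℤ_[p] (padicCoeffIntegers ι') z) ∧
      Continuous e ∧ Continuous e.symm := by
  have hbij : Function.Bijective (algebraMap ℤ_[p] (padicCoeffIntegers ι')) := ⟨algebraMap_padicInt_injective ι', hrat⟩
  let e : ℤ_[p] ≃+* padicCoeffIntegers ι' := RingEquiv.ofBijective _ hbij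
  have he : ∀ z, e z = algebraMap ℤ_[p] (padicCoeffIntegers ι') z := fun z => rfl
  have hc : Continuous e := by
    change Continuous fun z => e z
    simp_rw [he]
    exact padicCoeffIntegers.continuous_algebraMap_padicInt ι'
  let h : ℤ_[p] ≃ₜ padicCoeffIntegers ι' := Continuous.homeoOfEquivCompactToT2 (f := e.toEquiv) hc
  refine ⟨e, he, hc, ?_⟩
  have : (e.symm : padicCoeffIntegers ι' → ℤ_[p]) = h.symm := rfl
  rw [this]
  exact h.symm.continuous

end Coefficients

/-! ### §2. The member's representation framed over `ℤ_p` -/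

section Member

variable {M : ℕ} {k : ℤ} {g : CuspForm (Gamma0 M) k} {ι' : coeffField g →+* PadicAlgCl p}

/-- For a monic-shaped quadratic: if `P ∈ 𝒪[X]` maps to `X² − C a X + C b` in `ℚ̄_p[X]`, then `toPadicAlgCl (−P.coeff 1) = a` and
`toPadicAlgCl (P.coeff 0) = b`. [folklore] -/
theorem coeff_of_map_eq_quadratic (P : Polynomial (padicCoeffIntegers ι')) (a b : PadicAlgCl p)
    (h : P.map (padicCoeffIntegers.toPadicAlgCl ι') = Polynomial.X ^ 2 - Polynomial.C a * Polynomial.X + Polynomial.C b) :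
    padicCoeffIntegers.toPadicAlgCl ι' (P.coeff 1) = -a ∧ padicCoeffIntegers.toPadicAlgCl ι' (P.coeff 0) = b := by
  have h1 := congrArg (fun Q => Polynomial.coeff Q 1) h
  have h0 := congrArg (fun Q => Polynomial.coeff Q 0) h
  simp only [Polynomial.coeff_map, Polynomial.coeff_add, Polynomial.coeff_sub, Polynomial.coeff_X_pow, Polynomial.coeff_C_mul,
    Polynomial.coeff_X_one, Polynomial.coeff_C, Polynomial.coeff_X_zero] at h1 h0
  norm_num at h1 h0
  exact ⟨h1, h0⟩

/-- **The member's Deligne representation framed over `ℤ_p`.** Under (F-rat) there is `ρ : Γ_ℚ →ₜ* GL₂(ℤ_p)` mapping entrywise to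
`Δ.ρ` under `ℤ_p → 𝒪`, unramified at every `ℓ ∤ Mp`, and at every arithmetic Frobenius `σ` there its characteristic polynomial
maps to `X² − ι(a_ℓ(g))X + ℓ^{k−1}` in `ℚ̄_p[X]`, its trace maps to `ι(a_ℓ(g))`, and its determinant is `ℓ^{k−1} ∈ ℤ_p`
(all read off `OrdinaryNewformDatum.charpoly`). [cite: EmertonPollackWeston2006, §3.1 (p. 17)] [cite: Hida1986, §2 (2.1a) (2.1b)] -/
theorem exists_padicInt_frame (Δ : OrdinaryNewformDatum g p ι')
    (hrat : Function.Surjective (algebraMap ℤ_[p] (padicCoeffIntegers ι'))) :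
    ∃ ρ : FramedGaloisRep ℚ ℤ_[p] 2,
      (∀ σ, (((ρ σ : GL (Fin 2) ℤ_[p]) : Matrix (Fin 2) (Fin 2) ℤ_[p]).map (algebraMap ℤ_[p] (padicCoeffIntegers ι'))) =
        ((Δ.ρ σ : GL (Fin 2) (padicCoeffIntegers ι')) : Matrix (Fin 2) (Fin 2) (padicCoeffIntegers ι'))) ∧
      ∀ v : HeightOneSpectrum (𝓞 ℚ), ¬ ((Rat.HeightOneSpectrum.primesEquiv v : Nat.Primes) : ℕ) ∣ M →
        ((Rat.HeightOneSpectrum.primesEquiv v : Nat.Primes) : ℕ) ≠ p →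
        ρ.IsUnramifiedAt v ∧
        ∀ 𝔓 ∈ v.primesAbove, ∀ σ : absoluteGaloisGroup ℚ, IsArithFrobAt (𝓞 ℚ) σ 𝔓 →
          (((ρ σ : GL (Fin 2) ℤ_[p]) : Matrix (Fin 2) (Fin 2) ℤ_[p]).charpoly.map
              ((algebraMap ℚ_[p] (PadicAlgCl p)).comp PadicInt.Coe.ringHom) =
            Polynomial.X ^ 2
              - Polynomial.C (ι' ⟨(qExpansion 1 ⇑g).coeff ((Rat.HeightOneSpectrum.primesEquiv v : Nat.Primes) : ℕ),
                  coeff_mem_coeffField g _⟩) * Polynomial.X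
              + Polynomial.C ((((Rat.HeightOneSpectrum.primesEquiv v : Nat.Primes) : ℕ) : PadicAlgCl p) ^ (k - 1).toNat)) ∧
          algebraMap ℚ_[p] (PadicAlgCl p) ((((ρ σ : GL (Fin 2) ℤ_[p]) : Matrix (Fin 2) (Fin 2) ℤ_[p]).trace : ℤ_[p]) : ℚ_[p]) =
            ι' ⟨(qExpansion 1 ⇑g).coeff ((Rat.HeightOneSpectrum.primesEquiv v : Nat.Primes) : ℕ), coeff_mem_coeffField g _⟩ ∧
          ((ρ σ : GL (Fin 2) ℤ_[p]) : Matrix (Fin 2) (Fin 2) ℤ_[p]).det =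
            (((Rat.HeightOneSpectrum.primesEquiv v : Nat.Primes) : ℕ) : ℤ_[p]) ^ (k - 1).toNat := by
  obtain ⟨e, he, -, hesymm⟩ := exists_ringEquiv_of_surjective_algebraMap ι' hrat
  set f : padicCoeffIntegers ι' →+* ℤ_[p] := e.symm.toRingHom with hf
  have hfe : ∀ y, algebraMap ℤ_[p] (padicCoeffIntegers ι') (f y) = y := fun y => by
    rw [← he]; exact e.apply_symm_apply y
  have hfc : Continuous f := hesymm
  let ρ : FramedGaloisRep ℚ ℤ_[p] 2 := FramedRep.baseChange f hfc Δ.ρ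
  have hρ : ∀ σ, (((ρ σ : GL (Fin 2) ℤ_[p]) : Matrix (Fin 2) (Fin 2) ℤ_[p]).map (algebraMap ℤ_[p] (padicCoeffIntegers ι'))) =
      ((Δ.ρ σ : GL (Fin 2) (padicCoeffIntegers ι')) : Matrix (Fin 2) (Fin 2) (padicCoeffIntegers ι')) := by
    intro σ
    rw [FramedRep.coe_baseChange_apply, Matrix.map_map]
    refine Matrix.ext fun i j => ?_
    rw [Matrix.map_apply]
    exact hfe _
  -- the composite `ℚ̄_p ← ℚ_p ← ℤ_p ← 𝒪` is `toPadicAlgCl`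
  have hcomp : ((algebraMap ℚ_[p] (PadicAlgCl p)).comp PadicInt.Coe.ringHom).comp f = padicCoeffIntegers.toPadicAlgCl ι' := by
    refine RingHom.ext fun y => ?_
    rw [RingHom.comp_apply, ← toPadicAlgCl_comp_algebraMap ι', RingHom.comp_apply, hfe]
  refine ⟨ρ, hρ, fun v hvM hvp => ?_⟩
  obtain ⟨hunr, P, hP, hPfrob⟩ := Δ.charpoly v hvM hvp
  refine ⟨TelescopeBranchUntwistedOfFrobenius.isUnramifiedAt_baseChange f hfc hunr, fun 𝔓 h𝔓 σ hσ => ?_⟩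
  have hch : ((ρ σ : GL (Fin 2) ℤ_[p]) : Matrix (Fin 2) (Fin 2) ℤ_[p]).charpoly = P.map f := by
    change FramedRep.charpoly ρ σ = _
    rw [FramedRep.charpoly_baseChange, hPfrob 𝔓 h𝔓 σ hσ]
  obtain ⟨hc1, hc0⟩ := coeff_of_map_eq_quadratic P _ _ hP
  refine ⟨?_, ?_, ?_⟩
  · rw [hch, Polynomial.map_map, hcomp, hP]
  · -- trace = −coeff 1 of the characteristic polynomial
    rw [Matrix.trace_eq_neg_charpoly_coeff, hch, Polynomial.coeff_map]
    have : Fintype.card (Fin 2) - 1 = 1 := rfl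
    rw [this, PadicInt.coe_neg, map_neg]
    have h3 : ((algebraMap ℚ_[p] (PadicAlgCl p)).comp PadicInt.Coe.ringHom) (f (P.coeff 1)) =
        padicCoeffIntegers.toPadicAlgCl ι' (P.coeff 1) := by
      rw [← hcomp]; rfl
    have h4 : algebraMap ℚ_[p] (PadicAlgCl p) ((f (P.coeff 1) : ℤ_[p]) : ℚ_[p]) = padicCoeffIntegers.toPadicAlgCl ι' (P.coeff 1) := h3
    rw [h4, hc1, neg_neg]
  · -- det = coeff 0 of the characteristic polynomial = ℓ^{k−1}
    rw [Matrix.det_eq_sign_charpoly_coeff, hch, Polynomial.coeff_map, Fintype.card_fin,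
      show ((-1 : ℤ_[p])) ^ 2 = 1 by norm_num, one_mul]
    -- `f (P.coeff 0) = ℓ^{k-1}`: compare in `ℚ̄_p`
    have hinj : Function.Injective ((algebraMap ℚ_[p] (PadicAlgCl p)).comp PadicInt.Coe.ringHom) :=
      fun a b h => PadicInt.ext ((algebraMap ℚ_[p] (PadicAlgCl p)).injective h)
    apply hinj
    have h3 : ((algebraMap ℚ_[p] (PadicAlgCl p)).comp PadicInt.Coe.ringHom) (f (P.coeff 0)) =
        padicCoeffIntegers.toPadicAlgCl ι' (P.coeff 0) := by
      rw [← hcomp]; rfl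
    rw [h3, hc0, map_pow, map_natCast]

end Member

/-! ### §3. Oddness from the Frobenius determinants -/

section Odd

/-- The finite set of places of `ℚ` dividing `N ≠ 0`. [folklore] -/
theorem finite_setOf_primesEquiv_dvd {N : ℕ} (hN : N ≠ 0) :
    {v : HeightOneSpectrum (𝓞 ℚ) | ((Rat.HeightOneSpectrum.primesEquiv v : Nat.Primes) : ℕ) ∣ N}.Finite := by
  have h1 : ({m : ℕ | m ∣ N} : Set ℕ).Finite := (Set.finite_le_nat N).subset fun m hm => Nat.le_of_dvd (Nat.pos_of_ne_zero hN) hm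
  have h2 : ((Subtype.val : Nat.Primes → ℕ) ⁻¹' {m : ℕ | m ∣ N}).Finite := Set.Finite.preimage (Subtype.val_injective.injOn) h1
  have h3 : ((fun v : HeightOneSpectrum (𝓞 ℚ) => (Rat.HeightOneSpectrum.primesEquiv v : Nat.Primes)) ⁻¹'
      ((Subtype.val : Nat.Primes → ℕ) ⁻¹' {m : ℕ | m ∣ N})).Finite :=
    Set.Finite.preimage (Rat.HeightOneSpectrum.primesEquiv.injective.injOn) h2
  exact h3

/-- If `p ∣ N` and `ℓ_v ∤ N` then `v ∤ p`. [folklore] -/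
theorem natCast_not_mem_asIdeal {N : ℕ} (hpN : p ∣ N) (v : HeightOneSpectrum (𝓞 ℚ))
    (hv : ¬ ((Rat.HeightOneSpectrum.primesEquiv v : Nat.Primes) : ℕ) ∣ N) : ((p : ℕ) : 𝓞 ℚ) ∉ v.asIdeal := by
  intro hmem
  have h1 : Rat.HeightOneSpectrum.natGenerator v ∣ p := by
    rw [Rat.HeightOneSpectrum.natGenerator_dvd_iff, Ideal.mem_map_of_equiv]
    exact ⟨p, hmem, map_natCast _ p⟩
  have h2 : (Rat.HeightOneSpectrum.primesEquiv v : ℕ) = p :=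
    (Nat.prime_dvd_prime_iff_eq (Rat.HeightOneSpectrum.prime_natGenerator v) (Fact.out : p.Prime)).mp h1
  exact hv (h2 ▸ hpN)

/-- **Oddness from Frobenius determinants.** Let `ρ : Γ_ℚ →ₜ* GL₂(ℤ_p)` be continuous with `det ρ(σ) = ℓ_v^n` at every arithmetic
Frobenius `σ` above every `v` with `ℓ_v ∤ N` (`p ∣ N ≠ 0`), `n` ODD. Then `det ρ(c) = −1` for every complex conjugation `c`: `det ρ`
and `ε^n` are continuous characters agreeing at those Frobenii (`ε(Frob_v) = ℓ_v`), hence equal by the tree's Frobenius-division density,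
and `ε(c) = −1`. [cite: SerreAbelianLadic1968, Ch. I §1.2 (cyclotomic character), §2.2 Cor. 2 (a)] [cite: DarmonDiamondTaylor1995, Thm. 3.1 (b)] -/
theorem det_eq_neg_one_of_isComplexConjugation (ρ : FramedGaloisRep ℚ ℤ_[p] 2) {N : ℕ} (hN : N ≠ 0) (hpN : p ∣ N) (n : ℕ)
    (hn : Odd n)
    (hdet : ∀ v : HeightOneSpectrum (𝓞 ℚ), ¬ ((Rat.HeightOneSpectrum.primesEquiv v : Nat.Primes) : ℕ) ∣ N →
      ∀ 𝔓 ∈ v.primesAbove, ∀ σ : absoluteGaloisGroup ℚ, IsArithFrobAt (𝓞 ℚ) σ 𝔓 →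
        ((ρ σ : GL (Fin 2) ℤ_[p]) : Matrix (Fin 2) (Fin 2) ℤ_[p]).det =
          (((Rat.HeightOneSpectrum.primesEquiv v : Nat.Primes) : ℕ) : ℤ_[p]) ^ n)
    {φ : ℚ →+* ℝ} {c : absoluteGaloisGroup ℚ} (hc : IsComplexConjugation φ c) :
    ((ρ c : GL (Fin 2) ℤ_[p]) : Matrix (Fin 2) (Fin 2) ℤ_[p]).det = -1 := by
  -- the two characters `Γ_ℚ →* ℤ_p`: `det ∘ ρ` and `εⁿ`
  let χ₁ : absoluteGaloisGroup ℚ →* ℤ_[p] :=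
    (Matrix.detMonoidHom : Matrix (Fin 2) (Fin 2) ℤ_[p] →* ℤ_[p]).comp ((Units.coeHom _).comp ρ.toMonoidHom)
  let χ₂ : absoluteGaloisGroup ℚ →* ℤ_[p] :=
    (powMonoidHom n).comp ((Units.coeHom ℤ_[p]).comp (GaloisRep.cyclotomicCharacter ℚ p).toMonoidHom)
  have hχ₁ : ∀ σ, χ₁ σ = ((ρ σ : GL (Fin 2) ℤ_[p]) : Matrix (Fin 2) (Fin 2) ℤ_[p]).det := fun σ => rfl
  have hχ₂ : ∀ σ, χ₂ σ = ((GaloisRep.cyclotomicCharacter ℚ p σ : ℤ_[p]ˣ) : ℤ_[p]) ^ n := fun σ => rfl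
  have h1c : Continuous χ₁ := by
    change Continuous fun σ => χ₁ σ
    simp_rw [hχ₁]
    exact (Units.continuous_val.comp (map_continuous ρ)).matrix_det
  have h2c : Continuous χ₂ := by
    change Continuous fun σ => χ₂ σ
    simp_rw [hχ₂]
    exact (Units.continuous_val.comp (map_continuous _)).pow n
  have heq : χ₁ = χ₂ := by
    refine absoluteGaloisGroup.monoidHom_eq_of_frobenius' (f := (id : ℤ_[p] → ℤ_[p])) Function.injective_id
      (finite_setOf_primesEquiv_dvd hN) h1c h2c fun v hv 𝔓 h𝔓 Φ hΦ => ?_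
    rw [Set.mem_setOf_eq] at hv
    rw [hχ₁, hχ₂, hdet v hv 𝔓 h𝔓 Φ hΦ, GaloisRep.cyclotomicCharacter_apply_of_isArithFrobAt (natCast_not_mem_asIdeal hpN v hv) h𝔓 hΦ,
      Rat.residueCard_eq_natGenerator]
    rfl
  have := congrArg (fun χ : absoluteGaloisGroup ℚ →* ℤ_[p] => χ c) heq
  simp only [hχ₁, hχ₂] at this
  rw [this, GaloisRep.cyclotomicCharacter_of_isComplexConjugation p hc, hn.neg_one_pow]

end Odd

end Summit.BirchSwinnertonDyer.BirchSwinnertonDyer.Theorems.TelescopeBranchMemberFrames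

end
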